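import Mathlib
import Summits.MatrixMultiplication.MatrixMultiplication.Theorems.LieRankDesigns.Negative.Basics

/-!
# `LieRankDesigns` (stmt-MatrixMultiplication-7614), line `Sketch`: stub B `stub_parabolicFacts` — the parabolic bookkeeping

Crux `Summit.MatrixMultiplication.MatrixMultiplication.Theses.LevelGradedCohnUmans.LieRankDesigns`; skeleton
`Cruxes/LieRankDesigns/Lines/Sketch.lean` (lead prover-line-stmt-MatrixMultiplication-7614-0, 7 registered stubs A–G);
this file proves the registered stub `stub_parabolicFacts` verbatim (name + signature) and lands
`--supports stmt-MatrixMultiplication-7614`.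

Content. `G = GL_m(𝔽_p)`, `1 ≤ k ≤ m`, blocks of sizes `k`, `m-k`; `H = H_k = [[1,*],[0,*]]` (first `k` columns
those of `1`), `Z = Z_k = [[λ·1,*],[0,*]]` (first `k` columns `λ` times those of `1`), `P = P_k = [[*,*],[0,*]]`
(lower-left block `0`) are subgroups (`exists_subgroup_of_mul_mem`: in a finite group a product-closed subset
containing `1` is a subgroup), `H ≤ Z ≤ P`, and `g h g⁻¹ ∈ H`, `g z g⁻¹ z⁻¹ ∈ H` (`g ∈ P`, `h ∈ H`, `z ∈ Z`) are
column computations (`mul_apply_of_cols`, `mul_apply_congr_of_cols`).  Indices: `a⁻¹ b ∈ H` iff `a`, `b` have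
the same first `k` columns (`inv_mul_frame_iff`), so `[G:H] ≤ p^{mk}` and `[P:H] ≤ p^{k²}`; the block-diagonal
copy `[[A,0],[0,1]]` of `GL_k(𝔽_p)` in `P` gives `[P:H] ≥ |GL_k(𝔽_p)| ≥ p^{k²}/2^k` (`Matrix.card_GL_field`), so
`[G:P] = [G:H]/[P:H] ≤ 2^k p^{k(m-k)}`; the block scalars `diag(u·1_k, 1)`, `u ∈ 𝔽_pˣ`, give `[Z:H] ≥ p-1`, so
`[P:Z](p-1) ≤ [P:Z][Z:H] = [P:H] ≤ p^{k²}`.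
-/

set_option linter.dupNamespace false

noncomputable section

open scoped BigOperators
open Literature.RepresentationTheory.FiniteGroups
open Summit.MatrixMultiplication.MatrixMultiplication.Theorems.LieRankDesigns.Negative
  (GLm Mat fourierFn RankSupp RankSep levelSet budget volume)

namespace Summit.MatrixMultiplication.MatrixMultiplication.Theorems.LieRankDesigns

namespace ParabolicFacts

/-! ### Group theory: subgroups of finite groups from product-closed subsets; index bounds -/

/-- In a finite group a subset containing `1` and closed under products is (the carrier of) a subgroup:
`a⁻¹ = a ^ (orderOf a - 1)`. [folklore] -/
theorem exists_subgroup_of_mul_mem {G : Type*} [Group G] [Finite G] (S : Set G) (h1 : (1 : G) ∈ S)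
    (hmul : ∀ a ∈ S, ∀ b ∈ S, a * b ∈ S) : ∃ K : Subgroup G, ∀ g, g ∈ K ↔ g ∈ S := by
  let M : Submonoid G :=
    { carrier := S, one_mem' := h1, mul_mem' := fun {a} {b} ha hb => hmul a ha b hb }
  refine ⟨{ M with inv_mem' := fun {a} ha => ?_ }, fun g => Iff.rfl⟩
  change a⁻¹ ∈ M
  rw [← one_mul a⁻¹, ← pow_one a, ← pow_orderOf_eq_one a, ← pow_sub a (orderOf_pos a)]
  exact M.pow_mem ha (orderOf a - 1)

/-- `[G:H] ≤ |T|` whenever some `f : G → T` separates the left cosets of `H`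
(`f a = f b → a⁻¹ b ∈ H`). [folklore] -/
theorem index_le_card {G T : Type*} [Group G] [Finite T] (H : Subgroup G) (f : G → T)
    (hf : ∀ a b, f a = f b → a⁻¹ * b ∈ H) : H.index ≤ Nat.card T := by
  rw [Subgroup.index_eq_card]
  refine Nat.card_le_card_of_injective (fun q : G ⧸ H => f q.out) fun a b hab => ?_
  rw [← QuotientGroup.out_eq' a, ← QuotientGroup.out_eq' b, QuotientGroup.eq]
  exact hf _ _ hab

/-- `[K : H ∩ K] ≤ |T|` whenever some `f : G → T` separates, inside `K`, the left cosets of `H`. [folklore] -/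
theorem relIndex_le_card {G T : Type*} [Group G] [Finite T] (H K : Subgroup G) (f : G → T)
    (hf : ∀ a ∈ K, ∀ b ∈ K, f a = f b → a⁻¹ * b ∈ H) : H.relIndex K ≤ Nat.card T := by
  rw [Subgroup.relIndex]
  refine index_le_card (H.subgroupOf K) (fun a : K => f a) fun a b hab => ?_
  rw [Subgroup.mem_subgroupOf, Subgroup.coe_mul, Subgroup.coe_inv]
  exact hf a a.2 b b.2 hab

/-- `|T| ≤ [K : H ∩ K]` whenever some `ι : T → K` hits pairwise distinct left cosets of `H`. [folklore] -/
theorem card_le_relIndex {G T : Type*} [Group G] [Finite G] (H K : Subgroup G) (ι : T → G)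
    (hK : ∀ t, ι t ∈ K) (hι : ∀ s t, (ι s)⁻¹ * ι t ∈ H → s = t) : Nat.card T ≤ H.relIndex K := by
  rw [Subgroup.relIndex, Subgroup.index_eq_card]
  refine Nat.card_le_card_of_injective
    (fun t => ((⟨ι t, hK t⟩ : K) : K ⧸ H.subgroupOf K)) fun s t hst => ?_
  have h := QuotientGroup.eq.mp hst
  rw [Subgroup.mem_subgroupOf, Subgroup.coe_mul, Subgroup.coe_inv] at h
  exact hι s t h

/-! ### Column computations in `M_m(𝔽_p)` -/

variable {p m : ℕ}

/-- If the first `k` columns of `y` are `c` times those of `1`, then the first `k` columns of `x y` are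
`c` times those of `x`. [folklore] -/
theorem mul_apply_of_cols {k : ℕ} {x y : Mat p m} {c : ZMod p}
    (hy : ∀ i j : Fin m, (i : ℕ) < k → y j i = c * (1 : Mat p m) j i) :
    ∀ i j : Fin m, (i : ℕ) < k → (x * y) j i = c * x j i := by
  intro i j hi
  rw [Matrix.mul_apply]
  calc ∑ l, x j l * y l i = ∑ l, c * (x j l * (1 : Mat p m) l i) := by
        refine Finset.sum_congr rfl fun l _ => ?_
        rw [hy i l hi]
        ring
    _ = c * (x * (1 : Mat p m)) j i := by rw [Matrix.mul_apply, Finset.mul_sum]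
    _ = c * x j i := by rw [Matrix.mul_one]

/-- If the first `k` columns of `y` are those of `1`, then `x y` and `x` have the same first `k` columns.
[folklore] -/
theorem mul_apply_of_frame {k : ℕ} {x y : Mat p m}
    (hy : ∀ i j : Fin m, (i : ℕ) < k → y j i = (1 : Mat p m) j i) :
    ∀ i j : Fin m, (i : ℕ) < k → (x * y) j i = x j i := by
  intro i j hi
  have hy' : ∀ i j : Fin m, (i : ℕ) < k → y j i = 1 * (1 : Mat p m) j i :=
    fun i j hi => by rw [one_mul]; exact hy i j hi
  rw [mul_apply_of_cols hy' i j hi, one_mul]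

/-- If the lower-left block of `c` vanishes and `x`, `y` have the same first `k` columns, then so do
`x c` and `y c`. [folklore] -/
theorem mul_apply_congr_of_cols {k : ℕ} {x y c : Mat p m}
    (hc : ∀ i j : Fin m, (i : ℕ) < k → k ≤ (j : ℕ) → c j i = 0)
    (hxy : ∀ i j : Fin m, (i : ℕ) < k → x j i = y j i) :
    ∀ i j : Fin m, (i : ℕ) < k → (x * c) j i = (y * c) j i := by
  intro i j hi
  rw [Matrix.mul_apply, Matrix.mul_apply]
  refine Finset.sum_congr rfl fun l _ => ?_
  by_cases hl : (l : ℕ) < k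
  · rw [hxy l j hl]
  · rw [hc i l hi (not_lt.mp hl), mul_zero, mul_zero]

/-- Coset criterion for the frame stabiliser: the first `k` columns of `a⁻¹ b` are those of `1` iff `a` and
`b` have the same first `k` columns. [folklore] -/
theorem inv_mul_frame_iff {k : ℕ} (a b : GLm p m) :
    (∀ i j : Fin m, (i : ℕ) < k → ((a⁻¹ * b : GLm p m) : Mat p m) j i = (1 : Mat p m) j i) ↔
      ∀ i j : Fin m, (i : ℕ) < k → (b : Mat p m) j i = (a : Mat p m) j i := by
  constructor
  · intro h i j hi
    have hb : (b : Mat p m) = (a : Mat p m) * ((a⁻¹ * b : GLm p m) : Mat p m) := by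
      rw [← Units.val_mul, mul_inv_cancel_left]
    rw [hb, mul_apply_of_frame h i j hi]
  · intro h i j hi
    rw [Units.val_mul, Matrix.mul_apply]
    calc ∑ l, ((a⁻¹ : GLm p m) : Mat p m) j l * (b : Mat p m) l i
          = ∑ l, ((a⁻¹ : GLm p m) : Mat p m) j l * (a : Mat p m) l i :=
            Finset.sum_congr rfl fun l _ => by rw [h i l hi]
      _ = (((a⁻¹ : GLm p m) : Mat p m) * (a : Mat p m)) j i := (Matrix.mul_apply).symm
      _ = (1 : Mat p m) j i := by rw [Units.inv_mul]

/-! ### The subgroups `H_k ≤ Z_k ≤ P_k` -/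

/-- **The frame stabiliser `H_k`** (first `k` columns those of `1`) is a subgroup of `GL_m(𝔽_p)` (same statement
as `LevelFixedVector.exists_frameStab` of stub A, re-derived here from `exists_subgroup_of_mul_mem`). [folklore] -/
theorem exists_frameStab (p m k : ℕ) [Fact p.Prime] :
    ∃ H : Subgroup (GLm p m), ∀ h : GLm p m,
      h ∈ H ↔ ∀ i j : Fin m, (i : ℕ) < k → (h : Mat p m) j i = (1 : Mat p m) j i := by
  refine exists_subgroup_of_mul_mem
    {h : GLm p m | ∀ i j : Fin m, (i : ℕ) < k → (h : Mat p m) j i = (1 : Mat p m) j i} ?_ ?_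
  · intro i j _
    rw [Units.val_one]
  · intro a ha b hb i j hi
    simp only [Set.mem_setOf_eq] at ha hb
    rw [Units.val_mul, mul_apply_of_frame hb i j hi, ha i j hi]

/-- **`Z_k`** (first `k` columns a common scalar multiple of those of `1`) is a subgroup of `GL_m(𝔽_p)`.
[folklore] -/
theorem exists_blockCentre (p m k : ℕ) [Fact p.Prime] :
    ∃ Z : Subgroup (GLm p m), ∀ g : GLm p m,
      g ∈ Z ↔ ∃ c : ZMod p, ∀ i j : Fin m, (i : ℕ) < k → (g : Mat p m) j i = c * (1 : Mat p m) j i := by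
  refine exists_subgroup_of_mul_mem
    {g : GLm p m | ∃ c : ZMod p, ∀ i j : Fin m, (i : ℕ) < k →
      (g : Mat p m) j i = c * (1 : Mat p m) j i} ?_ ?_
  · exact ⟨1, fun i j _ => by rw [Units.val_one, one_mul]⟩
  · rintro a ⟨ca, ha⟩ b ⟨cb, hb⟩
    refine ⟨cb * ca, fun i j hi => ?_⟩
    rw [Units.val_mul, mul_apply_of_cols hb i j hi, ha i j hi, mul_assoc]

/-- **The parabolic `P_k`** (lower-left `(m-k) × k` block zero) is a subgroup of `GL_m(𝔽_p)`. [folklore] -/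
theorem exists_parabolic (p m k : ℕ) [Fact p.Prime] :
    ∃ P : Subgroup (GLm p m), ∀ g : GLm p m,
      g ∈ P ↔ ∀ i j : Fin m, (i : ℕ) < k → k ≤ (j : ℕ) → (g : Mat p m) j i = 0 := by
  refine exists_subgroup_of_mul_mem
    {g : GLm p m | ∀ i j : Fin m, (i : ℕ) < k → k ≤ (j : ℕ) → (g : Mat p m) j i = 0} ?_ ?_
  · intro i j hi hj
    rw [Units.val_one]
    exact Matrix.one_apply_ne fun h => by
      have := congrArg Fin.val h
      omega
  · intro a ha b hb i j hi hj
    simp only [Set.mem_setOf_eq] at ha hb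
    rw [Units.val_mul, Matrix.mul_apply]
    refine Finset.sum_eq_zero fun l _ => ?_
    by_cases hl : (l : ℕ) < k
    · rw [ha l j hl hj, zero_mul]
    · rw [hb i l hi (not_lt.mp hl), mul_zero]

/-! ### Special elements: block-diagonal `[[A,0],[0,1]]` and block scalars `diag(u·1_k, 1)` -/

/-- The block-diagonal matrix `[[A, 0], [0, 1]]` (`A ∈ GL_k(𝔽_p)`, `k ≤ m`) is an element of `GL_m(𝔽_p)` with
vanishing lower-left block and upper-left block `A`. [folklore] -/
theorem exists_blockDiag [Fact p.Prime] {k : ℕ} (hkm : k ≤ m) (A : GL (Fin k) (ZMod p)) :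
    ∃ g : GLm p m, (∀ i j : Fin m, (i : ℕ) < k → k ≤ (j : ℕ) → (g : Mat p m) j i = 0) ∧
      ∀ x y : Fin k, (g : Mat p m) (Fin.castLE hkm x) (Fin.castLE hkm y) =
        (A : Matrix (Fin k) (Fin k) (ZMod p)) x y := by
  have hkn : k + (m - k) = m := Nat.add_sub_cancel' hkm
  -- block coordinates `Fin k ⊕ Fin (m - k) ≃ Fin m`
  set e : Fin k ⊕ Fin (m - k) ≃ Fin m := finSumFinEquiv.trans (finCongr hkn) with he
  have he1 : ∀ (i : Fin m) (hi : (i : ℕ) < k), e.symm i = Sum.inl ⟨i, hi⟩ := by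
    intro i hi
    rw [he, Equiv.symm_trans_apply,
      show (finCongr hkn).symm i = Fin.castAdd (m - k) ⟨i, hi⟩ from Fin.ext rfl]
    exact finSumFinEquiv_symm_apply_castAdd _
  have he2 : ∀ (j : Fin m), k ≤ (j : ℕ) → ∃ z : Fin (m - k), e.symm j = Sum.inr z := by
    intro j hj
    refine ⟨⟨j - k, by omega⟩, ?_⟩
    rw [he, Equiv.symm_trans_apply,
      show (finCongr hkn).symm j = Fin.natAdd k ⟨j - k, by omega⟩ from
        Fin.ext (by change (j : ℕ) = k + ((j : ℕ) - k); omega)]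
    exact finSumFinEquiv_symm_apply_natAdd _
  set N : Matrix (Fin k ⊕ Fin (m - k)) (Fin k ⊕ Fin (m - k)) (ZMod p) :=
    Matrix.fromBlocks (A : Matrix (Fin k) (Fin k) (ZMod p)) 0 0 1 with hN
  set M : Mat p m := Matrix.reindex e e N with hM
  have hMu : IsUnit M := by
    rw [Matrix.isUnit_iff_isUnit_det, hM, Matrix.det_reindex_self, hN, Matrix.det_fromBlocks_zero₂₁,
      Matrix.det_one, mul_one, ← Matrix.isUnit_iff_isUnit_det]
    exact Units.isUnit A
  refine ⟨hMu.unit, fun i j hi hj => ?_, fun x y => ?_⟩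
  · obtain ⟨z, hz⟩ := he2 j hj
    rw [hMu.unit_spec, hM, Matrix.reindex_apply, Matrix.submatrix_apply, hz, he1 i hi, hN,
      Matrix.fromBlocks_apply₂₁]
    rfl
  · rw [hMu.unit_spec, hM, Matrix.reindex_apply, Matrix.submatrix_apply, he1 _ x.isLt, he1 _ y.isLt, hN,
      Matrix.fromBlocks_apply₁₁]
    rfl

/-- The block scalar `diag(u·1_k, 1_{m-k})` (`u ∈ 𝔽_pˣ`) is an element of `GL_m(𝔽_p)`; its entries. [folklore] -/
theorem exists_blockScalar (p m k : ℕ) [Fact p.Prime] (u : (ZMod p)ˣ) :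
    ∃ g : GLm p m, ∀ i j : Fin m,
      (g : Mat p m) j i = (if (i : ℕ) < k then (u : ZMod p) else 1) * (1 : Mat p m) j i := by
  obtain ⟨v, hv⟩ :
      ∃ v : Fin m → ZMod p, v = fun i : Fin m => if (i : ℕ) < k then (u : ZMod p) else 1 := ⟨_, rfl⟩
  have hu : IsUnit (Matrix.diagonal v) := by
    rw [Matrix.isUnit_diagonal, Pi.isUnit_iff]
    intro i
    rw [hv]
    dsimp only
    split_ifs
    exacts [Units.isUnit u, isUnit_one]
  refine ⟨hu.unit, fun i j => ?_⟩
  rw [hu.unit_spec]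
  by_cases h : j = i
  · subst h
    simp only [Matrix.diagonal_apply_eq, Matrix.one_apply_eq, mul_one, hv]
  · rw [Matrix.diagonal_apply_ne _ h, Matrix.one_apply_ne h, mul_zero]

/-- `p^{k²} ≤ 2^k · |GL_k(𝔽_p)|`: each factor of `|GL_k(𝔽_p)| = Π_{i<k} (p^k - p^i)` is at least `p^k / 2`.
[folklore] -/
theorem pow_sq_le_card_GL (p k : ℕ) [hp : Fact p.Prime] :
    p ^ (k * k) ≤ 2 ^ k * Nat.card (GL (Fin k) (ZMod p)) := by
  rw [Matrix.card_GL_field, ZMod.card]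
  calc p ^ (k * k) = ∏ _i : Fin k, p ^ k := by
        rw [Finset.prod_const, Finset.card_univ, Fintype.card_fin, ← pow_mul]
    _ ≤ ∏ i : Fin k, 2 * (p ^ k - p ^ (i : ℕ)) := by
        refine Finset.prod_le_prod (fun i _ => Nat.zero_le _) fun i _ => ?_
        have hi := i.isLt
        have h1 : p ^ (i : ℕ) * 2 ≤ p ^ (i : ℕ) * p ^ (k - i) :=
          Nat.mul_le_mul_left _ (le_trans hp.out.two_le (Nat.le_self_pow (by omega) p))
        rw [← pow_add, Nat.add_sub_cancel' hi.le] at h1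
        omega
    _ = 2 ^ k * ∏ i : Fin k, (p ^ k - p ^ (i : ℕ)) := by
        rw [Finset.prod_mul_distrib, Finset.prod_const, Finset.card_univ, Fintype.card_fin]

end ParabolicFacts

open ParabolicFacts in
/-- **Stub B `ParabolicFacts`** (registered signature, `IsFrameFix` inlined).  In `G = GL_m(𝔽_p)`, `1 ≤ k ≤ m`:
the frame stabiliser `H = H_k = [[1,*],[0,*]]`, `Z = Z_k = [[λ·1,*],[0,*]]` and the parabolic
`P = P_k = [[*,*],[0,*]]` (block sizes `k`, `m-k`) are subgroups with `H ≤ Z ≤ P`, `g H g⁻¹ ⊆ H` and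
`[g, Z] ⊆ H` for `g ∈ P`, and `[G:P] ≤ 2^m p^{k(m-k)}`, `[G:H] ≤ p^{mk}`, `[P:Z]·(p-1) ≤ p^{k²}`.  Proof:
column computations for the algebra; for the indices, `a⁻¹ b ∈ H ↔` equal first `k` columns gives
`[G:H] ≤ p^{mk}` and `[P:H] ≤ p^{k²}`, the block-diagonal copy of `GL_k(𝔽_p)` in `P` gives
`2^k [P:H] ≥ 2^k |GL_k(𝔽_p)| ≥ p^{k²}` (so `[G:P] = [G:H]/[P:H] ≤ 2^k p^{k(m-k)}`), and the block scalars
`diag(u·1_k, 1)`, `u ∈ 𝔽_pˣ`, give `[Z:H] ≥ p-1` (so `[P:Z](p-1) ≤ [P:Z][Z:H] = [P:H] ≤ p^{k²}`). -/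
theorem stub_parabolicFacts :
    ∀ (p m k : ℕ) [Fact p.Prime], 1 ≤ k → k ≤ m →
      ∃ H Z P : Subgroup (GLm p m),
        (∀ h : GLm p m, h ∈ H ↔ ∀ i j : Fin m, (i : ℕ) < k → (h : Mat p m) j i = (1 : Mat p m) j i) ∧
        H ≤ Z ∧ Z ≤ P ∧
        (∀ g ∈ P, ∀ h ∈ H, g * h * g⁻¹ ∈ H) ∧
        (∀ g ∈ P, ∀ z ∈ Z, g * z * g⁻¹ * z⁻¹ ∈ H) ∧
        (P.index : ℝ) ≤ 2 ^ m * (p : ℝ) ^ (k * (m - k)) ∧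
        (H.index : ℝ) ≤ (p : ℝ) ^ (m * k) ∧
        (Z.relIndex P : ℝ) * ((p : ℝ) - 1) ≤ (p : ℝ) ^ (k ^ 2) := by
  intro p m k hp hk hkm
  obtain ⟨H, hH⟩ := exists_frameStab p m k
  obtain ⟨Z, hZ⟩ := exists_blockCentre p m k
  obtain ⟨P, hP⟩ := exists_parabolic p m k
  -- inclusions
  have hHZ : H ≤ Z := fun g hg =>
    (hZ g).mpr ⟨1, fun i j hi => by rw [one_mul]; exact (hH g).mp hg i j hi⟩
  have hZP : Z ≤ P := fun g hg => by
    obtain ⟨c, hc⟩ := (hZ g).mp hg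
    refine (hP g).mpr fun i j hi hj => ?_
    rw [hc i j hi, Matrix.one_apply_ne fun h => ?_, mul_zero]
    have := congrArg Fin.val h
    omega
  -- normality of `H` in `P`
  have hnorm : ∀ g ∈ P, ∀ h ∈ H, g * h * g⁻¹ ∈ H := by
    intro g hg h hh
    have hg' := (hP _).mp (P.inv_mem hg)
    rw [hH] at hh ⊢
    intro i j hi
    rw [Units.val_mul, Units.val_mul, mul_apply_congr_of_cols hg' (mul_apply_of_frame hh) i j hi,
      Units.mul_inv]
  -- `[P, Z] ⊆ H`
  have hcomm : ∀ g ∈ P, ∀ z ∈ Z, g * z * g⁻¹ * z⁻¹ ∈ H := by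
    intro g hg z hz
    have hg' := (hP _).mp (P.inv_mem hg)
    have hz' := (hP _).mp (hZP (Z.inv_mem hz))
    obtain ⟨c, hc⟩ := (hZ z).mp hz
    rw [hH]
    -- `w := g z g⁻¹` has first `k` columns `c` times those of `1`
    have hgz : ∀ i j : Fin m, (i : ℕ) < k →
        ((g : Mat p m) * (z : Mat p m)) j i = (c • (g : Mat p m)) j i :=
      fun i j hi => by rw [mul_apply_of_cols hc i j hi, Matrix.smul_apply, smul_eq_mul]
    have hw : ∀ i j : Fin m, (i : ℕ) < k →
        ((g * z * g⁻¹ : GLm p m) : Mat p m) j i = (c • (1 : Mat p m)) j i := by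
      intro i j hi
      rw [Units.val_mul, Units.val_mul, mul_apply_congr_of_cols hg' hgz i j hi, Matrix.smul_mul,
        Units.mul_inv]
    intro i j hi
    rw [Units.val_mul, mul_apply_congr_of_cols hz' hw i j hi, Matrix.smul_mul, Matrix.one_mul,
      Matrix.smul_apply, smul_eq_mul]
    -- `c · (z⁻¹)_{ji} = 1_{ji}` from `z⁻¹ z = 1`
    rw [← Units.inv_mul z, mul_apply_of_cols hc i j hi]
  -- index bounds (natural numbers)
  have hHidx : H.index ≤ p ^ (m * k) := by
    have h := index_le_card H
      (fun g : GLm p m => fun (x : Fin k) (j : Fin m) => (g : Mat p m) j (Fin.castLE hkm x)) ?_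
    · rwa [Nat.card_fun, Nat.card_fun, Nat.card_zmod, Nat.card_fin, Nat.card_fin, ← pow_mul] at h
    · intro a b hab
      rw [hH]
      refine (inv_mul_frame_iff a b).mpr fun i j hi => ?_
      exact (congrFun (congrFun hab ⟨i, hi⟩) j).symm
  have hHPidx : H.relIndex P ≤ p ^ (k ^ 2) := by
    have h := relIndex_le_card H P
      (fun g : GLm p m => fun x y : Fin k => (g : Mat p m) (Fin.castLE hkm x) (Fin.castLE hkm y)) ?_
    · rwa [Nat.card_fun, Nat.card_fun, Nat.card_zmod, Nat.card_fin, ← pow_mul, ← sq] at h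
    · intro a ha b hb hab
      rw [hH]
      refine (inv_mul_frame_iff a b).mpr fun i j hi => ?_
      by_cases hj : (j : ℕ) < k
      · exact (congrFun (congrFun hab ⟨j, hj⟩) ⟨i, hi⟩).symm
      · rw [(hP a).mp ha i j hi (not_lt.mp hj), (hP b).mp hb i j hi (not_lt.mp hj)]
  have hGLle : Nat.card (GL (Fin k) (ZMod p)) ≤ H.relIndex P := by
    choose ι hιP hιA using fun A : GL (Fin k) (ZMod p) => exists_blockDiag (p := p) hkm A
    refine card_le_relIndex H P ι (fun A => (hP _).mpr (hιP A)) fun A B hAB => ?_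
    rw [hH] at hAB
    have hcols := (inv_mul_frame_iff _ _).mp hAB
    refine Matrix.GeneralLinearGroup.ext fun x y => ?_
    rw [← hιA A x y, ← hιA B x y]
    exact (hcols _ _ y.isLt).symm
  have hpZ : p - 1 ≤ H.relIndex Z := by
    choose d hd using fun u : (ZMod p)ˣ => exists_blockScalar p m k u
    have h := card_le_relIndex H Z d
      (fun u => (hZ _).mpr ⟨u, fun i j hi => by rw [hd u i j, if_pos hi]⟩) fun s t hst => ?_
    · rwa [Nat.card_eq_fintype_card, ZMod.card_units] at h
    · rw [hH] at hst
      have hcols := (inv_mul_frame_iff _ _).mp hst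
      have hi0 : ((⟨0, by omega⟩ : Fin m) : ℕ) < k := by show (0 : ℕ) < k; omega
      have h0 := hcols _ ⟨0, by omega⟩ hi0
      rw [hd, hd, if_pos hi0, if_pos hi0, Matrix.one_apply_eq, mul_one, mul_one] at h0
      exact (Units.ext h0).symm
  refine ⟨H, Z, P, hH, hHZ, hZP, hnorm, hcomm, ?_, ?_, ?_⟩
  · -- `[G:P] ≤ 2^m p^{k(m-k)}`
    have hPH : H.relIndex P * P.index = H.index := Subgroup.relIndex_mul_index (hHZ.trans hZP)
    have hmk : m * k = k * (m - k) + k * k := by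
      conv_lhs => rw [← Nat.sub_add_cancel hkm]
      ring
    have hnat : P.index * p ^ (k * k) ≤ 2 ^ k * p ^ (k * (m - k)) * p ^ (k * k) := by
      calc P.index * p ^ (k * k) ≤ P.index * (2 ^ k * H.relIndex P) :=
            Nat.mul_le_mul_left _ ((pow_sq_le_card_GL p k).trans (Nat.mul_le_mul_left _ hGLle))
        _ = 2 ^ k * (H.relIndex P * P.index) := by ring
        _ ≤ 2 ^ k * p ^ (m * k) := by rw [hPH]; exact Nat.mul_le_mul_left _ hHidx
        _ = 2 ^ k * p ^ (k * (m - k)) * p ^ (k * k) := by rw [hmk, pow_add, mul_assoc]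
    have hnat' : P.index ≤ 2 ^ m * p ^ (k * (m - k)) :=
      calc P.index ≤ 2 ^ k * p ^ (k * (m - k)) :=
            Nat.le_of_mul_le_mul_right hnat (pow_pos hp.out.pos _)
        _ ≤ 2 ^ m * p ^ (k * (m - k)) :=
            Nat.mul_le_mul_right _ (Nat.pow_le_pow_right two_pos hkm)
    exact_mod_cast hnat'
  · -- `[G:H] ≤ p^{mk}`
    exact_mod_cast hHidx
  · -- `[P:Z] (p-1) ≤ p^{k²}`
    have hnat : Z.relIndex P * (p - 1) ≤ p ^ (k ^ 2) :=
      calc Z.relIndex P * (p - 1) ≤ Z.relIndex P * H.relIndex Z := Nat.mul_le_mul_left _ hpZ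
        _ = H.relIndex P := by rw [mul_comm, Subgroup.relIndex_mul_relIndex H Z P hHZ hZP]
        _ ≤ p ^ (k ^ 2) := hHPidx
    have hp1 : ((p : ℝ) - 1) = ((p - 1 : ℕ) : ℝ) := by
      rw [Nat.cast_sub hp.out.one_le, Nat.cast_one]
    rw [hp1]
    exact_mod_cast hnat

end Summit.MatrixMultiplication.MatrixMultiplication.Theorems.LieRankDesigns

end
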